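import Summits.BirchSwinnertonDyer.BirchSwinnertonDyer.Theorems.PrintX11aLowerHalfNonSurjDoors
import Summits.BirchSwinnertonDyer.BirchSwinnertonDyer.Theorems.ErratumRoadFiveNonSurjCornerBranchesAn
import HarnessLib

/-!
# Route `ErratumRoadFive`, crux 6 `NonSurjCorner` (item 19065): the ANALYTIC glue WITHOUT the `X11aLowerHalf`
# binder — the corner's dependence on crux 19064 DISCHARGED from its own child `NonSurjCornerTwinMuAn`
# (item 19948) + named facts (seat bsd-line-er5-p2 = -w3 width seat of the 19064 line, «binder h₃»;
# `--supports stmt-BirchSwinnertonDyer-19064` helper — it is where 19064 is CONSUMED by the K2 route)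

HONEST FRAMING. Theorems only; no definition, no named fact, no `sorry`. Nothing here closes crux 19064
`X11aLowerHalf`, crux 19065 `NonSurjCorner`, or any registered stub; both theorems are CONDITIONAL on
displayed named facts (the 23 of `KatoTwinFactsFiveAn` + 6 Hida-family facts, one of them the statement-only
Literature instance `Wan2015.thm4_rational_weightK_member_of_bdd_ofLevel_irred`) and on the corner's
children Zₚᶜ ∕ Jₚᶜ ∕ TwinMuAn (OPEN). Route edits are the planner's; this file only lands the implication.
BSD is not proved for any curve or class by this file. beyond-print theorem: no.

## What

The registered glue of the split of `NonSurjCorner` is corner-p1 g6's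
`nonSurjCorner_of_branchesAn : KolyZ → KolyJ → TwinMuAn → KatoTwinFactsFiveAn → X11aLowerHalf → NonSurjCorner`
(binder 5 = item 19950, an ALIAS of crux 19064). Inside, `X11aLowerHalf` is applied ONLY to the Heegner
twists `E^{d_K}` of corner pairs, which are NON-surjective X11a pairs at the same `p ∈ {5,7}`
(`missingUpperBoundAt_corner_of_jetchevDivisibility_of_twinLeafLower`'s binder `hLtw`). On exactly that
locus the ¬Surj EPW ∕ Wan chain (`Theorems/PrintX11aLowerHalfNonSurj{Endpoint,Chain,Doors}.lean`) derives
the lower half from `μ^an = 0` — which IS binder 3's body. Hence: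

* `X11b.erratumRoadFive_nonSurjCorner_of_refinedKolyvagin_of_lowerNonSurj_of_twinMultDivisibility` —
  corner-p1 g4's theorem with `h₄ : X11aLowerHalf` WEAKENED to the restricted lower half (same proof);
* **`nonSurjCorner_of_branchesAn_of_hidaFacts : KolyZ → KolyJ → TwinMuAn → ⟨23 facts⟩ → ⟨6 facts⟩ →
  NonSurjCorner`** — NO `X11aLowerHalf` binder.

References: [EmertonPollackWeston2006] Thm. 1, 3.1.1, 5.1.3; [Wan2015] Thm. 4 = Thm. 103; [Cha2005] Thm. 21,
Rmk. 25; [MatarNekovar2019] §0.9, §0.11; [Kato2004Asterisque] Thm. 12.6, §17.13; cell files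
`pub/bsd-stepL/line-er5-p2/`, `pub/bsd-stepL/STATUS.md` (RULINGS on the corner split).
-/

set_option autoImplicit false
set_option linter.dupNamespace false -- the directory name repeats the summit name (sibling precedent)

noncomputable section

open scoped Classical NumberField MatrixGroups ModularForm

open CongruenceSubgroup WeierstrassCurve
  Literature.NumberTheory.EllipticCurves
  Literature.NumberTheory.EllipticCurves.ModularForms
  Literature.NumberTheory.EllipticCurves.Rank1Residual
  Literature.NumberTheory.EllipticCurves.Rank1Residual.Typed
  Literature.NumberTheory.EllipticCurves.Wuthrich2014
  Literature.NumberTheory.EllipticCurves.SteinWuthrich2013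
  Literature.NumberTheory.EllipticCurves.Greenberg1999
  Literature.NumberTheory.EllipticCurves.Kato2004
  Literature.NumberTheory.EllipticCurves.GreenbergVatsal2000
  Literature.NumberTheory.EllipticCurves.EmertonPollackWeston2006
  Summit.BirchSwinnertonDyer.Rank1Residual

namespace Summit.BirchSwinnertonDyer.Rank1Residual.X11b

open NumberField IsDedekindDomain Field Literature.NumberTheory.QuadraticFields.Quadratic
  Summit.BirchSwinnertonDyer.Rank1Residual.RankZeroHeightFree
  Summit.BirchSwinnertonDyer.Rank1Residual.X11b.Three.Koly
  Summit.BirchSwinnertonDyer.BirchSwinnertonDyer.Theorems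

/-- **Crux 6 `NonSurjCorner` (item 19065) ⇐ refined-Kolyvagin certificates + Jetchev divisibility + the
twin divisibility + the LOWER HALF ON THE NON-SURJECTIVE X11a TWINS AT `p ∈ {5,7}` ONLY** — corner-p1
g4's `erratumRoadFive_nonSurjCorner_of_refinedKolyvagin_of_lowerX11a_of_twinMultDivisibility` (p454452 ∕
`ErratumRoadFiveNonSurjCornerTwinKato.lean`) VERBATIM, with its binder
`h₄ : Theses.ErratumRoadFive.X11aLowerHalf` (crux 19064, ALL X11a pairs) WEAKENED to the restricted shape
`hlow : ∀ Wd p, ClassX11a Wd p → ¬ Surj Wd p → (p = 5 ∨ p = 7) → Typed.MissingLowerBoundAt Wd p` — the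
only instances the proof consumes (`missingUpperBoundAt_corner_of_jetchevDivisibility_of_twinLeafLower`'s
`hLtw`: the Heegner twists `E^{d_K}` of a corner pair are NON-surjective X11a pairs at the same `p`).
CONDITIONAL; closes nothing by itself. [cite: Cha2005, Thm. 21 and Rmk. 25 (pp. 173–175)]
[cite: MatarNekovar2019, §0.9 and §0.11 (pp. 456–457)] [cite: Kato2004Asterisque, §17.13 (pp. 279–280)] -/
theorem erratumRoadFive_nonSurjCorner_of_refinedKolyvagin_of_lowerNonSurj_of_twinMultDivisibility
    (hGZ : ∀ (N : ℕ) [NeZero N] (W : WeierstrassCurve ℚ) (K : Type) [Field K] [NumberField K],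
      gross_zagier N W K)
    (hKo : ∀ (N : ℕ) [NeZero N] (W : WeierstrassCurve ℚ) (K : Type) [Field K] [NumberField K],
      kolyvagin N W K)
    (hWu : sha_dvd_analyticSha)
    (hGZK : rank_eq_analyticRank_of_analyticRank_le_one) (hmod : hasEntireLFunction_rat)
    (hnf : exists_isNewformOf) (hpar : nonempty_modularParametrizationData)
    (hFHs : friedbergHoffstein_exists_heegnerField_split_twist_ne_zero)
    (hMaz : mazur_not_dvd_maninConstant_of_odd)
    (hrec : ∀ (N : ℕ) [NeZero N] (W : WeierstrassCurve ℚ) (K : Type) [Field K] [NumberField K],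
      heegnerPointOfConductor_one_galoisConj N W K)
    (hD36 : ∀ (N : ℕ) [NeZero N] (W : WeierstrassCurve ℚ) (K : Type) [Field K] [NumberField K],
      phi_heegnerTau_mem_singularModuliField N W K)
    (hJs : thm61_splitMultiplicative) (hJn : thm61_nonsplitMultiplicative)
    (hGS : ∀ (W : WeierstrassCurve ℚ) [W.IsElliptic] [W.IsGloballyMinimal] (p : ℕ) [Fact p.Prime],
      greenberg_stevens (W := W) (p := p))
    (hChaL : Cha2005.rmk25_pow_dvd_card_sha_primary_of_certificate)
    (hChaU : Cha2005.rmk25_padicValNat_card_sha_primary_add_le_of_globalDivisibility)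
    (hlow : ∀ (Wd : WeierstrassCurve ℚ) [Wd.IsElliptic] [Wd.IsGloballyMinimal] (p : ℕ) [Fact p.Prime],
      ClassX11a Wd p → ¬ Surj Wd p → (p = 5 ∨ p = 7) → Typed.MissingLowerBoundAt Wd p)
    (hZ : ∀ (W : WeierstrassCurve ℚ) [W.IsElliptic] [W.IsGloballyMinimal] (p : ℕ) [Fact p.Prime]
      (N : ℕ) [NeZero N] (K : Type) [Field K] [NumberField K]
      (Dt : ModularParametrizationData W N) (β : ℤ) (ι : K →+* ℂ),
      ClassX11b W p → ¬ Surj W p → (p = 5 ∨ p = 7) → p ∣ padicValInt p W.minimalDiscriminantInt →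
      ¬ Ram W p → W.conductorNorm ℤ = N → IsImaginaryQuadratic K →
      4 < (NumberField.discr K).natAbs → SatisfiesHeegnerHypothesis N K →
      SatisfiesHeegnerHypothesis p K → (4 * (N : ℤ)) ∣ β ^ 2 - NumberField.discr K → ¬ (p : ℤ) ∣ Dt.c →
      ∃ M : ℕ, M ≤ padicValNat p W.tamagawaProduct ∧ CertificateAt Dt β ι p M)
    (hJ : ∀ (W : WeierstrassCurve ℚ) [W.IsElliptic] [W.IsGloballyMinimal] [NeZero (W.conductorNorm ℤ)]
      (p : ℕ) [Fact p.Prime] (K : Type) [Field K] [NumberField K]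
      (Dt : ModularParametrizationData W (W.conductorNorm ℤ)) (β : ℤ) (ι : K →+* ℂ),
      ClassX11b W p → ¬ Surj W p → (p = 5 ∨ p = 7) → p ∣ padicValInt p W.minimalDiscriminantInt →
      ¬ Ram W p → IsImaginaryQuadratic K → 4 < (NumberField.discr K).natAbs →
      SatisfiesHeegnerHypothesis (W.conductorNorm ℤ) K → SatisfiesHeegnerHypothesis p K →
      (4 * (W.conductorNorm ℤ : ℤ)) ∣ β ^ 2 - NumberField.discr K → ¬ (p : ℤ) ∣ Dt.c →
      ∀ (s : ℕ), s ≤ padicValNat p W.tamagawaProduct →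
        ∀ (n : ℕ) (d : KolyvaginHeegnerData Dt β ι n), Squarefree n →
          (∀ ℓ ∈ n.primeFactors, Zhang2014.IsKolyvaginPrime (W.conductorNorm ℤ) W K p ℓ ∧
            s ≤ Zhang2014.kolyvaginIndex W p ℓ) → PDiv d p s)
    (hdiv : ∀ (Wd : WeierstrassCurve ℚ) [Wd.IsElliptic] [Wd.IsGloballyMinimal] (p : ℕ) [Fact p.Prime],
      ClassX11a Wd p → ¬ Surj Wd p → (p = 5 ∨ p = 7) →
      p ∣ padicValInt p Wd.minimalDiscriminantInt → MultDivisibilityAt Wd p) :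
    Summit.BirchSwinnertonDyer.BirchSwinnertonDyer.Theses.ErratumRoadFive.NonSurjCorner := by
  -- adapted from `erratumRoadFive_nonSurjCorner_of_refinedKolyvagin_of_lowerX11a_of_twinMultDivisibility`
  intro W _ _ p _ hX hns h57 hv hnr
  have hp5 : 5 ≤ p := by rcases h57 with h | h <;> omega
  have hleafU : ∀ (Wd : WeierstrassCurve ℚ) [Wd.IsElliptic] [Wd.IsGloballyMinimal],
      ClassX11a Wd p → ¬ Surj Wd p → p ∣ padicValInt p Wd.minimalDiscriminantInt →
      Typed.MissingUpperBoundAt Wd p := fun Wd _ _ hXa hnsd hvd ↦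
    missingUpperBoundAt_of_classX11a_of_multDivisibilityAt hJs hJn hGZK hmod hpar Wd p (hGS Wd p) hXa
      (hdiv Wd p hXa hnsd h57 hvd)
  refine Typed.missingPPartAt_of_lower_of_upper W p ?_
    (missingUpperBoundAt_corner_of_jetchevDivisibility_of_twinLeafLower hGZ hKo hGZK hmod hnf hFHs hMaz
      hrec hD36 hChaU W p hX hns h57 hv hnr
      (fun Wd _ _ hXa hnsd _ ↦ hlow Wd p hXa hnsd h57)
      (fun K _ _ Dt β ι hK hdisc hHN hHp hβ hc ↦
        hJ W p K Dt β ι hX hns h57 hv hnr hK hdisc hHN hHp hβ hc))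
  refine missingLowerBoundAt_of_classX11b_of_indexLowerBoundNoSurj_of_upperTwist hGZ hKo hWu hGZK
    hmod hnf hFHs hMaz W p hX hp5
    (fun N _ K _ _ Dt H ι P hN hK hdisc hHN hHp hLt hP hc hPinf ↦
      indexLowerBoundAt_corner_of_certificates hGZ hKo hmod hrec hD36 hChaL W p N K Dt H ι P hX hp5 hN
        hK hdisc hHN hLt hP hPinf (hZ W p N K Dt H.β ι hX hns h57 hv hnr hN hK hdisc hHN hHp H.dvd_sq_sub hc))
    ?_
  intro K _ _ Wd _ _ Cd hK hHN hLt hWd hnsd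
  have hD0 : (NumberField.discr K : ℚ) ≠ 0 := by exact_mod_cast NumberField.discr_ne_zero K
  haveI : (W.quadraticTwist (NumberField.discr K : ℚ)).IsElliptic := W.isElliptic_quadraticTwist hD0
  have hrd : Wd.analyticRank = 0 := by
    rw [← hWd, analyticRank_smul]
    exact analyticRank_eq_zero_of_entireLFunction_one_ne_zero _ hLt
  have hXa : ClassX11a Wd p := classX11a_twist_of_not_ram W p hX hnr K hK hHN Cd hWd hrd
  have hpN : p ∣ W.conductorNorm ℤ := dvd_conductorNorm_of_mult hX.2.2.1
  have hsq := isSquare_discr_padic_of_heegner K hK hHN p hpN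
  have hvd : p ∣ padicValInt p Wd.minimalDiscriminantInt := by
    rw [padicValInt_minimalDiscriminantInt_twist_eq W p hD0 hsq Cd hWd]
    exact hv
  exact hleafU Wd hXa hnsd hvd

end Summit.BirchSwinnertonDyer.Rank1Residual.X11b

namespace Summit.BirchSwinnertonDyer.BirchSwinnertonDyer.Theorems

open Summit.BirchSwinnertonDyer.Rank1Residual.X11b Summit.BirchSwinnertonDyer.BirchSwinnertonDyer.Theorems.NonSurjChain

/-- **GLUE VARIANT WITHOUT THE `X11aLowerHalf` BINDER: Zₚᶜ → Jₚᶜ → TwinMuAn → ⟨the 23 facts of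
`KatoTwinFactsFiveAn`⟩ → ⟨6 Hida-family facts⟩ → `NonSurjCorner`.** Same as corner-p1 g6's
`nonSurjCorner_of_branchesAn` (the registered glue of the split of crux 19065, binder 5 = item 19950 :=
`X11aLowerHalf`), except that the lower half on the non-surjective X11a twins at `p ∈ {5,7}` is now DERIVED
from binder 3 (`NonSurjCornerTwinMuAn` = item 19948: `μ^an = 0` on the whole non-surjective X11a locus at
`p ∈ {5,7}`) by the ¬Surj EPW ∕ Wan chain
(`NonSurjChain.lowerNonSurj_fiveSeven_of_nonSurjCornerTwinMuAn_of_facts`, `Theorems/PrintX11aLowerHalfNonSurjDoors.lean`),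
at the price of SIX more named facts (`hH`, in order): EPW 2006 Thm. 3.1.1 ∕ Thm. 1 (alg) at any tame level
(`thm311_cotorsion_weightK_member_ofLevel`, `thm1_muAlg_of_weightK_member_ofLevel`), Wan 2015 Thm. 4
rational part under the PRINTED (irred) (`Wan2015.thm4_rational_weightK_member_of_bdd_ofLevel_irred`), EPW
Thm. 5.1.3 bounded (`thm513_transfer_from_weightK_member_of_bdd_ofLevel`), Deligne–Serre 1974 Thm. 6.1
(`DeligneSerre1974.thm61_exists_adicGaloisRep`), Hida/Wiles 3.26 (`Hida2000_thm326_ordinary`). TURNKEY for the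
ErratumRoadFive planner (their call): re-split `NonSurjCorner` as KolyZ → KolyJ → TwinMuAn →
KatoTwinFactsFiveAn ∧ ⟨hH⟩ → NonSurjCorner, DROPPING binder 19950 (:= crux 19064) from the corner.
CONDITIONAL; closes nothing by itself; BSD is not proved by any of this.
[cite: EmertonPollackWeston2006, Thm. 1, Thm. 3.1.1, Thm. 5.1.3] [cite: Wan2015, Thm. 4 (pp. 4–5) = Thm. 103 (pp. 91–92)]
[cite: Cha2005, Thm. 21 and Rmk. 25 (pp. 173–175)] [cite: Kato2004Asterisque, Thm. 12.6 (p. 222) and §17.13 (pp. 279–280)] -/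
theorem nonSurjCorner_of_branchesAn_of_hidaFacts (hZ : NonSurjCornerKolyZ) (hJ : NonSurjCornerKolyJ)
    (hμ : NonSurjCornerTwinMuAn)
    (hF :
      (∀ (N : ℕ) [NeZero N] (W : WeierstrassCurve ℚ) (K : Type) [Field K] [NumberField K], gross_zagier N W K) ∧
      (∀ (N : ℕ) [NeZero N] (W : WeierstrassCurve ℚ) (K : Type) [Field K] [NumberField K], kolyvagin N W K) ∧
      sha_dvd_analyticSha ∧
      rank_eq_analyticRank_of_analyticRank_le_one ∧
      WeierstrassCurve.hasEntireLFunction_rat ∧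
      exists_isNewformOf ∧
      nonempty_modularParametrizationData ∧
      friedbergHoffstein_exists_heegnerField_split_twist_ne_zero ∧
      mazur_not_dvd_maninConstant_of_odd ∧
      (∀ (N : ℕ) [NeZero N] (W : WeierstrassCurve ℚ) (K : Type) [Field K] [NumberField K],
        heegnerPointOfConductor_one_galoisConj N W K) ∧
      (∀ (N : ℕ) [NeZero N] (W : WeierstrassCurve ℚ) (K : Type) [Field K] [NumberField K],
        phi_heegnerTau_mem_singularModuliField N W K) ∧
      thm61_splitMultiplicative ∧
      thm61_nonsplitMultiplicative ∧
      (∀ (W : WeierstrassCurve ℚ) [W.IsElliptic] [W.IsGloballyMinimal] (p : ℕ) [Fact p.Prime],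
        greenberg_stevens (W := W) (p := p)) ∧
      Cha2005.rmk25_pow_dvd_card_sha_primary_of_certificate ∧
      Cha2005.rmk25_padicValNat_card_sha_primary_add_le_of_globalDivisibility ∧
      Kato2004.nonempty_iwasawaH1Data ∧
      Kato2004.thm12_4 ∧
      Kato2004.exists_multDivisibilityInputs_nonsplit ∧
      Kato2004.exists_multDivisibilityInputs_split ∧
      thm15_isTorsion_multiplicative_rat ∧
      Wuthrich2014.corollary18_padicLFunction_mem_iwasawaAlgebra_multiplicative ∧
      Kato2004.exists_multDivisibilityInputs_fine)
    (hH : thm311_cotorsion_weightK_member_ofLevel ∧ thm1_muAlg_of_weightK_member_ofLevel ∧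
      Wan2015.thm4_rational_weightK_member_of_bdd_ofLevel_irred ∧
      thm513_transfer_from_weightK_member_of_bdd_ofLevel ∧
      DeligneSerre1974.thm61_exists_adicGaloisRep ∧ Hida2000_thm326_ordinary) :
    Summit.BirchSwinnertonDyer.BirchSwinnertonDyer.Theses.ErratumRoadFive.NonSurjCorner := by
  obtain ⟨hGZ, hKo, hWu, hGZK, hmod, hnf, hpar, hFHs, hMaz, hrec, hD36, hJs, hJn, hGS, hChaL, hChaU, hne, h12,
    hns, hsp, h15, h18, hfine⟩ := hF
  obtain ⟨h311, hT1a, hT2, hT1b, h61, h326⟩ := hH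
  exact erratumRoadFive_nonSurjCorner_of_refinedKolyvagin_of_lowerNonSurj_of_twinMultDivisibility hGZ hKo hWu
    hGZK hmod hnf hpar hFHs hMaz hrec hD36 hJs hJn hGS hChaL hChaU
    (lowerNonSurj_fiveSeven_of_nonSurjCornerTwinMuAn_of_facts hnf h311 hT1a hT2 hT1b h61 h326 h12 hns hsp h15
      h18 hfine hJs hJn hGZK hGS hμ)
    (fun W _ _ p _ N _ K _ _ Dt β ι ↦ hZ W p N K Dt β ι) (fun W _ _ _ p _ K _ _ Dt β ι ↦ hJ W p K Dt β ι)
    (fun Wd _ _ p _ hXa hnsd h57 hvd ↦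
      multDivisibilityAt_of_katoFacts_of_muAn hne h12 hns hsp h15 h18 hfine Wd p hXa.2.1 hXa.2.2.1
        hXa.2.2.2.1 hnsd (fun f hf ϖ hϖ a L hsa hna hL ↦ hμ Wd p hXa hnsd h57 hvd f hf ϖ hϖ a L hsa hna hL))

end Summit.BirchSwinnertonDyer.BirchSwinnertonDyer.Theorems

end
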